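import Summits.QuantumFields.BalabanUV.Beta.ResolventFinCertificate

/-!
# Beta / CapRouteAFins — ROUTE A'S ANCHORS WITH (W) := FIN RECTANGLES: every numerical binder of row CAP-k except (T), (N), (Z2b) is a box
# leaf of ONE certificate type
# (β sub-cell, BINDER-OWNERS row CAP-k, lineage `b2b-balaban-beta-an5`, gen 25; node BETA-an5-g25-FINS, leaf 2b = END; journal CLAIM l.16546)

`TubeZeroFreeFins` (leaf 1, p224731): THEOREM DB's winding datum at a reference slice follows from zero-freeness on two 2-real-dimensional FINS;
for the cell's reflection-invariant `det k₀` the FOUR all-plus fins `{x·e_i + iτκ·(1,1,1,1) : x ∈ [−π, π], τ ∈ [0, 1]}` suffice.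
`ResolventFinCertificate` (leaf 2a): the fin leaf (`fin_certificate`, closed-form Lipschitz majorant, `of_fin_cover`, `finHyp_of_matNegTranspose`).
THIS LEAF re-issues the row's typed target:

* **`rowsOfOneLoopFormCode16E_routeA₂_ofBoxesRealShift_ofReflect_ofFins`** = `CapRouteABoxesReflect.…_ofReflect` with its binder `hW4` (four
  `SliceWindingEq` = 8 closed compass words) REPLACED by `hfin`: `IsUnit (A p).det` at the points of the four all-plus fins (pointwise form);
  `_eq`: it IS the four-slice anchor at the derived datum (`rfl`);
* **`…_ofReflect_ofFinRects`** — certificate currency: FOUR finite rectangle covers of `[0, 1] × [−π, π]` with per-rectangle certificates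
  `IsUnit (A p).det` (`ResolventFinCertificate.fin_certificate` ∕ any residual socket); `_k₀`;
* **`rowsOfOneLoopFormCode16E_routeA₂_ofBoxesRealShift_ofFins`** — the generic-symmetry twin = `CapRouteABoxes.…_ofBoxesRealShift` with `hW`
  REPLACED by fins through the `2^3` sign patterns at slope `+κ` (`32` fins; slope `−κ` from the binder `MatNegTranspose A`); `_k₀`.

THE ROW'S BINDER LIST AFTER THIS NODE (census v1.6 V27): (N) `hb` ∣ STRUCTURE `MatTubeHol` ×5, `MatNegTranspose A`, `MatConjSymm A`, `hR`
(det reflection-invariance; engines D∕E: `CapRouteABoxesReflect.det_reflectAt_of_relabel` from the G6 entry forms) ∣ (Z2a)+(F) ONE quarter-region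
box cover of the vertex tori, per leaf `IsUnit (A q).det ∧ ‖(A q)⁻¹‖ ≤ Ba` ∣ (W) FOUR fin-rectangle covers of `[0, 1] × [−π, π]`, per leaf
`IsUnit (A p).det` — the SAME certificate code ∣ (Z2b) `hSst hSs hSt` ∣ (T) `hT` ∣ (A) `hA₀` ∣ cmp `hlo`.  No compass word, no validated argument,
no LU-pivot phase of a `744`-dimensional determinant remains among the binders.

HONEST FRAMING.  Kernel glue: ONE constructor application each over leaf 1 + leaf 2a + the gen-23∕24 anchors; no box, no rectangle, no number
supplied; no fin certificate exists; 0 binders instantiated; 0 certified coefficients.  Discharging `BetaPertH` would make Bałaban's ultraviolet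
stability unconditional — NOT the continuum limit, NOT the Clay problem.  0 `sorry`, 0 cite tags.
-/

namespace Summit.QuantumFields.BalabanUV.Beta.CapRouteAFins

open Complex Set Matrix
open Literature.MathematicalPhysics.QuantumFieldTheory.Balaban1983to89
open B4Strip (Strip)
open B4ContourShift (latticeKernel)
open B4TorusKernel (descend gridPt)
open Beta.AliasingTailL1 (aliasRatioL1)
open Beta.AliasingTailLattice (codeTheta code16SetE)
open Summit.QuantumFields.BalabanUV.Beta.CapRows (Rows)
open Summit.QuantumFields.BalabanUV.Beta.TubeMaximumModulus
open Summit.QuantumFields.BalabanUV.Beta.VertexToriSymmetry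
open Summit.QuantumFields.BalabanUV.Beta.ConjReflectionAlgebra (MatConjSymm)
open Summit.QuantumFields.BalabanUV.Beta.ResolventBoxCertificate (Box)
open Summit.QuantumFields.BalabanUV.Beta.ResolventFinCertificate (of_fin_cover finHyp_of_matNegTranspose)
open Summit.QuantumFields.BalabanUV.Beta.CapRouteABoxes (rowsOfOneLoopFormCode16E_routeA₂_ofBoxesRealShift)
open Summit.QuantumFields.BalabanUV.Beta.CapRouteABoxesReflect (rowsOfOneLoopFormCode16E_routeA₂_ofBoxesRealShift_ofReflect)
open scoped Real Matrix.Norms.L2Operator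

noncomputable section

variable {n : Type*} [Fintype n] [DecidableEq n]

/-! ## The anchors with (W) := fins -/

section Anchor

variable {b : ℕ → ℝ} {A B C D : (Fin 4 → ℂ) → Matrix n n ℂ} {κ Ba Sst Ss St : ℝ} {c : Fin 4 → ℂ}

/-- **ROUTE A'S ANCHOR IN CERTIFICATE CURRENCY, (W) := FOUR ALL-PLUS FINS.**  Exactly `CapRouteABoxesReflect.rowsOfOneLoopFormCode16E_routeA₂_ofBoxesRealShift_ofReflect`
(data: (N) `hb`; STRUCTURE `MatTubeHol` ×5 at width `κ`, `MatNegTranspose A`, `MatConjSymm A`; ONE quarter-region box cover with per-leaf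
`IsUnit (A q).det ∧ ‖(A q)⁻¹‖ ≤ Ba`; `hR` det-invariance under the four coordinate reflections; (Z2b) stencil sups; (T) `hT`; (A) `hA₀`; cmp
`hlo`) with the binder `hW4` (four `SliceWindingEq`, eight closed compass words) REPLACED by **`hfin`**: invertibility of `A` at the points
`x·e_i + iτκ·(1,1,1,1)`, `x ∈ [−π, π]`, `τ ∈ [0, 1]`, of the FOUR all-plus fins (`TubeZeroFreeFins.sliceWindingEq_allPlus_of_fin`). [folklore] -/
def rowsOfOneLoopFormCode16E_routeA₂_ofBoxesRealShift_ofReflect_ofFins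
    (hb : b 0 = (latticeKernel (fun p => ((A p)⁻¹ * B p).trace - ((A p)⁻¹ * C p * (A (p - c))⁻¹ * D p).trace) 0).re)
    (hκ : 0 < κ) (hc : ∀ μ, (c μ).im = 0)
    (hA : MatTubeHol A (fun _ => κ)) (hA' : MatTubeHol (fun p => A (p - c)) (fun _ => κ))
    (hBst : MatTubeHol B (fun _ => κ)) (hBs : MatTubeHol C (fun _ => κ)) (hBt : MatTubeHol D (fun _ => κ))
    (hAn : MatNegTranspose A) (hAc : MatConjSymm A)
    (ν₀ ν₁ : Fin (3 + 1)) {ι : Type*} (boxes : Finset ι) (ctr : ι → Fin (3 + 1) → ℂ) (hw : ι → Fin (3 + 1) → ℝ)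
    (hcov : ∀ q ∈ VertexTori (fun _ : Fin (3 + 1) => κ), (q ν₀).im = κ → (q ν₁).re ≤ 0 → ∃ bx ∈ boxes, q ∈ Box (ctr bx) (hw bx))
    (hcert : ∀ bx ∈ boxes, ∀ q ∈ Box (ctr bx) (hw bx), IsUnit (A q).det ∧ ‖(A q)⁻¹‖ ≤ Ba)
    (hR : ∀ (ν : Fin (3 + 1)) (p : Fin (3 + 1) → ℂ), (A (reflectAt ν p)).det = (A p).det)
    (hfin : ∀ (i : Fin (3 + 1)), ∀ τ ∈ Icc (0 : ℝ) 1, ∀ x ∈ Icc (-π) π,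
      IsUnit (A (i.insertNth ((x : ℂ) + ((τ * κ : ℝ) : ℂ) * I) fun _ => ((τ * κ : ℝ) : ℂ) * I)).det)
    (hSst : ∀ p ∈ VertexTori (fun _ : Fin (3 + 1) => κ), ‖B p‖ ≤ Sst)
    (hSs : ∀ p ∈ VertexTori (fun _ : Fin (3 + 1) => κ), ‖C p‖ ≤ Ss)
    (hSt : ∀ p ∈ VertexTori (fun _ : Fin (3 + 1) => κ), ‖D p‖ ≤ St)
    {N : ℕ} (hN : 1 ≤ N) [NeZero (4 * N)] {t r : ℝ}
    (hT : ‖((code16SetE N).card : ℂ)⁻¹ *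
        (∑ w ∈ code16SetE N, descend (fun p => ((A p)⁻¹ * B p).trace - ((A p)⁻¹ * C p * (A (p - c))⁻¹ * D p).trace)
          (gridPt (4 * N) w)) - t‖ ≤ r)
    {A₀ : ℝ} (hA₀ : Fintype.card n * (Ba * Sst + Ba * Ss * Ba * St) * codeTheta (aliasRatioL1 κ N) ≤ A₀) (lo : ℚ)
    (hlo : ((lo : ℚ) : ℝ) ≤ t - r - A₀) : Rows b :=
  rowsOfOneLoopFormCode16E_routeA₂_ofBoxesRealShift_ofReflect hb hκ hc hA hA' hBst hBs hBt hAn hAc ν₀ ν₁ boxes ctr hw hcov hcert hR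
    (fun i => sliceWindingEq_allPlus_of_fin hA.det i (fun _ => hκ.le) (hR i) fun τ hτ x hx => (hfin i τ hτ x hx).ne_zero)
    hSst hSs hSt hN hT hA₀ lo hlo

/-- it IS the four-slice anchor at the derived (W) datum (definitional bookkeeping, for the cross-reader). [folklore] -/
theorem rowsOfOneLoopFormCode16E_routeA₂_ofBoxesRealShift_ofReflect_ofFins_eq
    (hb : b 0 = (latticeKernel (fun p => ((A p)⁻¹ * B p).trace - ((A p)⁻¹ * C p * (A (p - c))⁻¹ * D p).trace) 0).re)
    (hκ : 0 < κ) (hc : ∀ μ, (c μ).im = 0)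
    (hA : MatTubeHol A (fun _ => κ)) (hA' : MatTubeHol (fun p => A (p - c)) (fun _ => κ))
    (hBst : MatTubeHol B (fun _ => κ)) (hBs : MatTubeHol C (fun _ => κ)) (hBt : MatTubeHol D (fun _ => κ))
    (hAn : MatNegTranspose A) (hAc : MatConjSymm A)
    (ν₀ ν₁ : Fin (3 + 1)) {ι : Type*} (boxes : Finset ι) (ctr : ι → Fin (3 + 1) → ℂ) (hw : ι → Fin (3 + 1) → ℝ)
    (hcov : ∀ q ∈ VertexTori (fun _ : Fin (3 + 1) => κ), (q ν₀).im = κ → (q ν₁).re ≤ 0 → ∃ bx ∈ boxes, q ∈ Box (ctr bx) (hw bx))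
    (hcert : ∀ bx ∈ boxes, ∀ q ∈ Box (ctr bx) (hw bx), IsUnit (A q).det ∧ ‖(A q)⁻¹‖ ≤ Ba)
    (hR : ∀ (ν : Fin (3 + 1)) (p : Fin (3 + 1) → ℂ), (A (reflectAt ν p)).det = (A p).det)
    (hfin : ∀ (i : Fin (3 + 1)), ∀ τ ∈ Icc (0 : ℝ) 1, ∀ x ∈ Icc (-π) π,
      IsUnit (A (i.insertNth ((x : ℂ) + ((τ * κ : ℝ) : ℂ) * I) fun _ => ((τ * κ : ℝ) : ℂ) * I)).det)
    (hSst : ∀ p ∈ VertexTori (fun _ : Fin (3 + 1) => κ), ‖B p‖ ≤ Sst)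
    (hSs : ∀ p ∈ VertexTori (fun _ : Fin (3 + 1) => κ), ‖C p‖ ≤ Ss)
    (hSt : ∀ p ∈ VertexTori (fun _ : Fin (3 + 1) => κ), ‖D p‖ ≤ St)
    {N : ℕ} (hN : 1 ≤ N) [NeZero (4 * N)] {t r : ℝ}
    (hT : ‖((code16SetE N).card : ℂ)⁻¹ *
        (∑ w ∈ code16SetE N, descend (fun p => ((A p)⁻¹ * B p).trace - ((A p)⁻¹ * C p * (A (p - c))⁻¹ * D p).trace)
          (gridPt (4 * N) w)) - t‖ ≤ r)
    {A₀ : ℝ} (hA₀ : Fintype.card n * (Ba * Sst + Ba * Ss * Ba * St) * codeTheta (aliasRatioL1 κ N) ≤ A₀) (lo : ℚ)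
    (hlo : ((lo : ℚ) : ℝ) ≤ t - r - A₀) :
    rowsOfOneLoopFormCode16E_routeA₂_ofBoxesRealShift_ofReflect_ofFins hb hκ hc hA hA' hBst hBs hBt hAn hAc ν₀ ν₁ boxes ctr hw hcov
        hcert hR hfin hSst hSs hSt hN hT hA₀ lo hlo
      = rowsOfOneLoopFormCode16E_routeA₂_ofBoxesRealShift_ofReflect hb hκ hc hA hA' hBst hBs hBt hAn hAc ν₀ ν₁ boxes ctr hw hcov hcert
          hR (fun i => sliceWindingEq_allPlus_of_fin hA.det i (fun _ => hκ.le) (hR i) fun τ hτ x hx => (hfin i τ hτ x hx).ne_zero)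
          hSst hSs hSt hN hT hA₀ lo hlo := rfl

/-- **THE SAME IN CERTIFICATE CURRENCY FOR THE FINS TOO**: the (W) binder as FOUR finite rectangle covers of `[0, 1] × [−π, π]` (one per coordinate
`i`; rectangles `|τ − τc| ≤ hτ`, `|x − xc| ≤ hx`) with per-rectangle certificates `IsUnit (A p).det` at the fin points (`fin_certificate` ∕ any
residual socket) — the box-leaf type of the (Z2a) cover.  Every numerical binder except (T) `hT`, (N) `hb`, (Z2b) is now a leaf of ONE certificate
code. [folklore] -/
def rowsOfOneLoopFormCode16E_routeA₂_ofBoxesRealShift_ofReflect_ofFinRects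
    (hb : b 0 = (latticeKernel (fun p => ((A p)⁻¹ * B p).trace - ((A p)⁻¹ * C p * (A (p - c))⁻¹ * D p).trace) 0).re)
    (hκ : 0 < κ) (hc : ∀ μ, (c μ).im = 0)
    (hA : MatTubeHol A (fun _ => κ)) (hA' : MatTubeHol (fun p => A (p - c)) (fun _ => κ))
    (hBst : MatTubeHol B (fun _ => κ)) (hBs : MatTubeHol C (fun _ => κ)) (hBt : MatTubeHol D (fun _ => κ))
    (hAn : MatNegTranspose A) (hAc : MatConjSymm A)
    (ν₀ ν₁ : Fin (3 + 1)) {ι : Type*} (boxes : Finset ι) (ctr : ι → Fin (3 + 1) → ℂ) (hw : ι → Fin (3 + 1) → ℝ)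
    (hcov : ∀ q ∈ VertexTori (fun _ : Fin (3 + 1) => κ), (q ν₀).im = κ → (q ν₁).re ≤ 0 → ∃ bx ∈ boxes, q ∈ Box (ctr bx) (hw bx))
    (hcert : ∀ bx ∈ boxes, ∀ q ∈ Box (ctr bx) (hw bx), IsUnit (A q).det ∧ ‖(A q)⁻¹‖ ≤ Ba)
    (hR : ∀ (ν : Fin (3 + 1)) (p : Fin (3 + 1) → ℂ), (A (reflectAt ν p)).det = (A p).det)
    {ι' : Type*} (rects : Fin (3 + 1) → Finset ι') (τc xc hτ hx : Fin (3 + 1) → ι' → ℝ)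
    (hcovF : ∀ (i : Fin (3 + 1)), ∀ τ ∈ Icc (0 : ℝ) 1, ∀ x ∈ Icc (-π) π,
      ∃ bx ∈ rects i, |τ - τc i bx| ≤ hτ i bx ∧ |x - xc i bx| ≤ hx i bx)
    (hcertF : ∀ (i : Fin (3 + 1)), ∀ bx ∈ rects i, ∀ τ x : ℝ, |τ - τc i bx| ≤ hτ i bx → |x - xc i bx| ≤ hx i bx →
      IsUnit (A (i.insertNth ((x : ℂ) + ((τ * κ : ℝ) : ℂ) * I) fun _ => ((τ * κ : ℝ) : ℂ) * I)).det)
    (hSst : ∀ p ∈ VertexTori (fun _ : Fin (3 + 1) => κ), ‖B p‖ ≤ Sst)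
    (hSs : ∀ p ∈ VertexTori (fun _ : Fin (3 + 1) => κ), ‖C p‖ ≤ Ss)
    (hSt : ∀ p ∈ VertexTori (fun _ : Fin (3 + 1) => κ), ‖D p‖ ≤ St)
    {N : ℕ} (hN : 1 ≤ N) [NeZero (4 * N)] {t r : ℝ}
    (hT : ‖((code16SetE N).card : ℂ)⁻¹ *
        (∑ w ∈ code16SetE N, descend (fun p => ((A p)⁻¹ * B p).trace - ((A p)⁻¹ * C p * (A (p - c))⁻¹ * D p).trace)
          (gridPt (4 * N) w)) - t‖ ≤ r)
    {A₀ : ℝ} (hA₀ : Fintype.card n * (Ba * Sst + Ba * Ss * Ba * St) * codeTheta (aliasRatioL1 κ N) ≤ A₀) (lo : ℚ)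
    (hlo : ((lo : ℚ) : ℝ) ≤ t - r - A₀) : Rows b :=
  rowsOfOneLoopFormCode16E_routeA₂_ofBoxesRealShift_ofReflect_ofFins hb hκ hc hA hA' hBst hBs hBt hAn hAc ν₀ ν₁ boxes ctr hw hcov hcert hR
    (fun i => of_fin_cover (rects i) (τc i) (xc i) (hτ i) (hx i) (hcovF i) (hcertF i)) hSst hSs hSt hN hT hA₀ lo hlo

/-- its level is `k₀ = 0` (definitionally that of `CapRouteA.rowsOfOneLoopFormCode16E_routeA₂`). [folklore] -/
theorem rowsOfOneLoopFormCode16E_routeA₂_ofBoxesRealShift_ofReflect_ofFinRects_k₀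
    (hb : b 0 = (latticeKernel (fun p => ((A p)⁻¹ * B p).trace - ((A p)⁻¹ * C p * (A (p - c))⁻¹ * D p).trace) 0).re)
    (hκ : 0 < κ) (hc : ∀ μ, (c μ).im = 0)
    (hA : MatTubeHol A (fun _ => κ)) (hA' : MatTubeHol (fun p => A (p - c)) (fun _ => κ))
    (hBst : MatTubeHol B (fun _ => κ)) (hBs : MatTubeHol C (fun _ => κ)) (hBt : MatTubeHol D (fun _ => κ))
    (hAn : MatNegTranspose A) (hAc : MatConjSymm A)
    (ν₀ ν₁ : Fin (3 + 1)) {ι : Type*} (boxes : Finset ι) (ctr : ι → Fin (3 + 1) → ℂ) (hw : ι → Fin (3 + 1) → ℝ)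
    (hcov : ∀ q ∈ VertexTori (fun _ : Fin (3 + 1) => κ), (q ν₀).im = κ → (q ν₁).re ≤ 0 → ∃ bx ∈ boxes, q ∈ Box (ctr bx) (hw bx))
    (hcert : ∀ bx ∈ boxes, ∀ q ∈ Box (ctr bx) (hw bx), IsUnit (A q).det ∧ ‖(A q)⁻¹‖ ≤ Ba)
    (hR : ∀ (ν : Fin (3 + 1)) (p : Fin (3 + 1) → ℂ), (A (reflectAt ν p)).det = (A p).det)
    {ι' : Type*} (rects : Fin (3 + 1) → Finset ι') (τc xc hτ hx : Fin (3 + 1) → ι' → ℝ)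
    (hcovF : ∀ (i : Fin (3 + 1)), ∀ τ ∈ Icc (0 : ℝ) 1, ∀ x ∈ Icc (-π) π,
      ∃ bx ∈ rects i, |τ - τc i bx| ≤ hτ i bx ∧ |x - xc i bx| ≤ hx i bx)
    (hcertF : ∀ (i : Fin (3 + 1)), ∀ bx ∈ rects i, ∀ τ x : ℝ, |τ - τc i bx| ≤ hτ i bx → |x - xc i bx| ≤ hx i bx →
      IsUnit (A (i.insertNth ((x : ℂ) + ((τ * κ : ℝ) : ℂ) * I) fun _ => ((τ * κ : ℝ) : ℂ) * I)).det)
    (hSst : ∀ p ∈ VertexTori (fun _ : Fin (3 + 1) => κ), ‖B p‖ ≤ Sst)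
    (hSs : ∀ p ∈ VertexTori (fun _ : Fin (3 + 1) => κ), ‖C p‖ ≤ Ss)
    (hSt : ∀ p ∈ VertexTori (fun _ : Fin (3 + 1) => κ), ‖D p‖ ≤ St)
    {N : ℕ} (hN : 1 ≤ N) [NeZero (4 * N)] {t r : ℝ}
    (hT : ‖((code16SetE N).card : ℂ)⁻¹ *
        (∑ w ∈ code16SetE N, descend (fun p => ((A p)⁻¹ * B p).trace - ((A p)⁻¹ * C p * (A (p - c))⁻¹ * D p).trace)
          (gridPt (4 * N) w)) - t‖ ≤ r)
    {A₀ : ℝ} (hA₀ : Fintype.card n * (Ba * Sst + Ba * Ss * Ba * St) * codeTheta (aliasRatioL1 κ N) ≤ A₀) (lo : ℚ)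
    (hlo : ((lo : ℚ) : ℝ) ≤ t - r - A₀) :
    (rowsOfOneLoopFormCode16E_routeA₂_ofBoxesRealShift_ofReflect_ofFinRects hb hκ hc hA hA' hBst hBs hBt hAn hAc ν₀ ν₁ boxes ctr hw hcov
        hcert hR rects τc xc hτ hx hcovF hcertF hSst hSs hSt hN hT hA₀ lo hlo).k₀ = 0 := rfl

/-- **THE GENERIC-SYMMETRY TWIN, (W) := FINS THROUGH THE `2^3` SIGN PATTERNS.**  Exactly `CapRouteABoxes.rowsOfOneLoopFormCode16E_routeA₂_ofBoxesRealShift`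
with its binder `hW` (one `SliceWindingEq` per coordinate × sign pattern) REPLACED by `hfin`: invertibility of `A` at the fin points
`x·e_i + iτκ·(e_i + s')`, `s ∈ {±1}^3`, `x ∈ [−π, π]`, `τ ∈ [0, 1]` — slope `+κ` only: `(d+1)·2^d = 32` fins; the slope `−κ` fins come from the
binder `MatNegTranspose A` (`finHyp_of_matNegTranspose`).  For engines whose `det k₀` is not invariant under all four reflections. [folklore] -/
def rowsOfOneLoopFormCode16E_routeA₂_ofBoxesRealShift_ofFins
    (hb : b 0 = (latticeKernel (fun p => ((A p)⁻¹ * B p).trace - ((A p)⁻¹ * C p * (A (p - c))⁻¹ * D p).trace) 0).re)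
    (hκ : 0 < κ) (hc : ∀ μ, (c μ).im = 0)
    (hA : MatTubeHol A (fun _ => κ)) (hA' : MatTubeHol (fun p => A (p - c)) (fun _ => κ))
    (hBst : MatTubeHol B (fun _ => κ)) (hBs : MatTubeHol C (fun _ => κ)) (hBt : MatTubeHol D (fun _ => κ))
    (hAn : MatNegTranspose A) (hAc : MatConjSymm A)
    (ν₀ ν₁ : Fin (3 + 1)) {ι : Type*} (boxes : Finset ι) (ctr : ι → Fin (3 + 1) → ℂ) (hw : ι → Fin (3 + 1) → ℝ)
    (hcov : ∀ q ∈ VertexTori (fun _ : Fin (3 + 1) => κ), (q ν₀).im = κ → (q ν₁).re ≤ 0 → ∃ bx ∈ boxes, q ∈ Box (ctr bx) (hw bx))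
    (hcert : ∀ bx ∈ boxes, ∀ q ∈ Box (ctr bx) (hw bx), IsUnit (A q).det ∧ ‖(A q)⁻¹‖ ≤ Ba)
    (hfin : ∀ (i : Fin (3 + 1)) (s : Fin 3 → ℝ), (∀ j, s j = 1 ∨ s j = -1) →
      ∀ τ ∈ Icc (0 : ℝ) 1, ∀ x ∈ Icc (-π) π,
        IsUnit (A (i.insertNth ((x : ℂ) + ((τ * κ : ℝ) : ℂ) * I) fun j => ((τ * (s j * κ) : ℝ) : ℂ) * I)).det)
    (hSst : ∀ p ∈ VertexTori (fun _ : Fin (3 + 1) => κ), ‖B p‖ ≤ Sst)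
    (hSs : ∀ p ∈ VertexTori (fun _ : Fin (3 + 1) => κ), ‖C p‖ ≤ Ss)
    (hSt : ∀ p ∈ VertexTori (fun _ : Fin (3 + 1) => κ), ‖D p‖ ≤ St)
    {N : ℕ} (hN : 1 ≤ N) [NeZero (4 * N)] {t r : ℝ}
    (hT : ‖((code16SetE N).card : ℂ)⁻¹ *
        (∑ w ∈ code16SetE N, descend (fun p => ((A p)⁻¹ * B p).trace - ((A p)⁻¹ * C p * (A (p - c))⁻¹ * D p).trace)
          (gridPt (4 * N) w)) - t‖ ≤ r)
    {A₀ : ℝ} (hA₀ : Fintype.card n * (Ba * Sst + Ba * Ss * Ba * St) * codeTheta (aliasRatioL1 κ N) ≤ A₀) (lo : ℚ)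
    (hlo : ((lo : ℚ) : ℝ) ≤ t - r - A₀) : Rows b :=
  rowsOfOneLoopFormCode16E_routeA₂_ofBoxesRealShift hb hκ hc hA hA' hBst hBs hBt hAn hAc ν₀ ν₁ boxes ctr hw hcov hcert
    (windingHyp_of_fins hA.det (fun _ => hκ.le) fun i s hs σ hσ =>
      finHyp_of_matNegTranspose hAn hfin i s hs σ (by rw [hσ, abs_of_pos hκ]))
    hSst hSs hSt hN hT hA₀ lo hlo

/-- its level is `k₀ = 0`. [folklore] -/
theorem rowsOfOneLoopFormCode16E_routeA₂_ofBoxesRealShift_ofFins_k₀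
    (hb : b 0 = (latticeKernel (fun p => ((A p)⁻¹ * B p).trace - ((A p)⁻¹ * C p * (A (p - c))⁻¹ * D p).trace) 0).re)
    (hκ : 0 < κ) (hc : ∀ μ, (c μ).im = 0)
    (hA : MatTubeHol A (fun _ => κ)) (hA' : MatTubeHol (fun p => A (p - c)) (fun _ => κ))
    (hBst : MatTubeHol B (fun _ => κ)) (hBs : MatTubeHol C (fun _ => κ)) (hBt : MatTubeHol D (fun _ => κ))
    (hAn : MatNegTranspose A) (hAc : MatConjSymm A)
    (ν₀ ν₁ : Fin (3 + 1)) {ι : Type*} (boxes : Finset ι) (ctr : ι → Fin (3 + 1) → ℂ) (hw : ι → Fin (3 + 1) → ℝ)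
    (hcov : ∀ q ∈ VertexTori (fun _ : Fin (3 + 1) => κ), (q ν₀).im = κ → (q ν₁).re ≤ 0 → ∃ bx ∈ boxes, q ∈ Box (ctr bx) (hw bx))
    (hcert : ∀ bx ∈ boxes, ∀ q ∈ Box (ctr bx) (hw bx), IsUnit (A q).det ∧ ‖(A q)⁻¹‖ ≤ Ba)
    (hfin : ∀ (i : Fin (3 + 1)) (s : Fin 3 → ℝ), (∀ j, s j = 1 ∨ s j = -1) →
      ∀ τ ∈ Icc (0 : ℝ) 1, ∀ x ∈ Icc (-π) π,
        IsUnit (A (i.insertNth ((x : ℂ) + ((τ * κ : ℝ) : ℂ) * I) fun j => ((τ * (s j * κ) : ℝ) : ℂ) * I)).det)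
    (hSst : ∀ p ∈ VertexTori (fun _ : Fin (3 + 1) => κ), ‖B p‖ ≤ Sst)
    (hSs : ∀ p ∈ VertexTori (fun _ : Fin (3 + 1) => κ), ‖C p‖ ≤ Ss)
    (hSt : ∀ p ∈ VertexTori (fun _ : Fin (3 + 1) => κ), ‖D p‖ ≤ St)
    {N : ℕ} (hN : 1 ≤ N) [NeZero (4 * N)] {t r : ℝ}
    (hT : ‖((code16SetE N).card : ℂ)⁻¹ *
        (∑ w ∈ code16SetE N, descend (fun p => ((A p)⁻¹ * B p).trace - ((A p)⁻¹ * C p * (A (p - c))⁻¹ * D p).trace)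
          (gridPt (4 * N) w)) - t‖ ≤ r)
    {A₀ : ℝ} (hA₀ : Fintype.card n * (Ba * Sst + Ba * Ss * Ba * St) * codeTheta (aliasRatioL1 κ N) ≤ A₀) (lo : ℚ)
    (hlo : ((lo : ℚ) : ℝ) ≤ t - r - A₀) :
    (rowsOfOneLoopFormCode16E_routeA₂_ofBoxesRealShift_ofFins hb hκ hc hA hA' hBst hBs hBt hAn hAc ν₀ ν₁ boxes ctr hw hcov hcert hfin
        hSst hSs hSt hN hT hA₀ lo hlo).k₀ = 0 := rfl

end Anchor

end

end Summit.QuantumFields.BalabanUV.Beta.CapRouteAFins
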